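import Summits.CriticalPhenomena.PercolationContinuityZ3.Theorems.PercNearOneGluingAdditiveGluingGenPair
import Literature.Probability.Percolation.TwoSetConditionalAssociation
import Literature.Probability.Percolation.KozmaNitzanSeparatingTriple
import HarnessLib

/-!
# Merging the observer into the owner's cluster enlarges `C x ∪ C o` (given that `{x,o}` avoids `T`)

Support file (`--supports stmt-CriticalPhenomena-4575`, closed crux; independent mathematics on Kozma–Nitzan's Question 8 at
`|A| = 3`), prover `prim-ineq-gen-6` (gen 14).  No definitions, no named facts, no sorries; standard axioms.
Memo `prim-ineq-gen-6/FINDING-G14.md` §5(e): the qualitative half (c3) of the reduction (UPZ) ⟸ (DOM) = (c5) + (1−a)·(c3) of the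
centring-side atom of the PCOV / PCOV-Z certificate.

Setting: `μ = prodBernoulli w`, owner `x`, observer `o`, a vertex set `T` (in (c3): `T = {v} ∪ Y`), `Q = {x ↮ T} ∩ {o ↮ T}`
(`= {S ↮ T}`, `S = {x,o}`), `U = C x ∪ C o` (vertex sets) and `h` monotone on vertex sets, `f = h(U)`.
* `PocketCert.pocket_merge_dominates` — `μ(Q ∩ {o↮x}) · ∫_{Q ∩ {o↔x}} f ≥ μ(Q ∩ {o↔x}) · ∫_{Q ∩ {o↮x}} f`, i.e.
  `E[h(C x ∪ C o) | Q, o ↔ x] ≥ E[h(C x ∪ C o) | Q, o ↮ x]`: on `{o↔x}` the events `o↮v, o↮Y` are `x↮v, x↮Y`, so with `T = {v} ∪ Y`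
  this reads `law(U | o↔x, x↮v, x↮Y) ≽ law(U | o↮{x,v}∪Y, x↮v, x↮Y)` on increasing functionals — (c3) of the memo.
  PROOF: `h(U)` and `1{o↔x}` are increasing functions of the edge cluster `C_S` (`KNSep.reachable_iff_cluster`), so van den Berg–Häggström–Kahn's
  Theorem 1.3/2.1 with sets (`BHK2006_setClusterConditionalPositiveAssociation`) gives `(∫_Q f)·μ(Q ∩ {o↔x}) ≤ μ(Q)·∫_{Q∩{o↔x}} f`; subtract.
[cite: VandenbergHaggstromKahn2005, Thm. 2.1 (p. 9), Thm. 1.3 (p. 6), Remark 1 (p. 5)] [cite: KozmaNitzan2024, Question 8 (§5.5 p. 36)]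
-/

namespace Summit.CriticalPhenomena.PercolationContinuityZ3.Theorems

open MeasureTheory Set Literature.Probability.LatticeModels Literature.Probability.Percolation
open scoped Classical
open KNPreFKG

noncomputable section

namespace PocketCert

variable {V : Type*} [Fintype V]

/-- **(c3): merging the observer into the owner's cluster enlarges `C x ∪ C o`.**  For a vertex set `T`, `Q = {x↮T} ∩ {o↮T}`, and `h`
monotone on vertex sets: `μ(Q ∩ {o↮x}) · ∫_{Q ∩ {o↔x}} h(C x ∪ C o) ≥ μ(Q ∩ {o↔x}) · ∫_{Q ∩ {o↮x}} h(C x ∪ C o)`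
(vdBHK positive association of `C_{{x,o}}` given `{x,o} ↮ T`). [cite: VandenbergHaggstromKahn2005, Thm. 2.1 (p. 9)] -/
theorem pocket_merge_dominates (w : Sym2 V → unitInterval) (x o : V) (T : Set V) (h : Set V → ℝ)
    (hh : ∀ A B : Set V, A ⊆ B → h A ≤ h B) :
    (prodBernoulli w).real ({ω : BondConfig V | ∀ s ∈ ({x, o} : Set V), ∀ t ∈ T, ¬ (openGraph ω).Reachable s t} ∩ openConn o x) *
        ∫ ω in {ω : BondConfig V | ∀ s ∈ ({x, o} : Set V), ∀ t ∈ T, ¬ (openGraph ω).Reachable s t} ∩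
            {ω | ¬ (openGraph ω).Reachable o x}, h (openCluster ω x ∪ openCluster ω o) ∂(prodBernoulli w) ≤
      (prodBernoulli w).real ({ω : BondConfig V | ∀ s ∈ ({x, o} : Set V), ∀ t ∈ T, ¬ (openGraph ω).Reachable s t} ∩
            {ω | ¬ (openGraph ω).Reachable o x}) *
        ∫ ω in {ω : BondConfig V | ∀ s ∈ ({x, o} : Set V), ∀ t ∈ T, ¬ (openGraph ω).Reachable s t} ∩ openConn o x,
            h (openCluster ω x ∪ openCluster ω o) ∂(prodBernoulli w) := by
  classical
  set μ := prodBernoulli w with hμ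
  set f : BondConfig V → ℝ := fun ω => h (openCluster ω x ∪ openCluster ω o) with hf
  have hmeas : ∀ S' : Set (BondConfig V), MeasurableSet S' := fun _ => MeasurableSet.of_discrete
  have hint : ∀ (g : BondConfig V → ℝ) (S' : Set (BondConfig V)), IntegrableOn g S' μ :=
    fun g S' => (Integrable.of_finite).integrableOn
  have hn := fun (S' : Set (BondConfig V)) => (measureReal_nonneg : 0 ≤ μ.real S')
  set S : Set V := {x, o} with hS
  set Q : Set (BondConfig V) := {ω : BondConfig V | ∀ s ∈ S, ∀ t ∈ T, ¬ (openGraph ω).Reachable s t} with hQ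
  set Ox : Set (BondConfig V) := openConn o x with hOx
  -- the two monotone functionals of the edge cluster `C_S`
  set Fe : Set (Sym2 V) → ℝ := fun C => h ({a | (openGraph C).Reachable x a} ∪ {a | (openGraph C).Reachable o a}) with hFe
  set Ge : Set (Sym2 V) → ℝ := fun C => if (openGraph C).Reachable o x then 1 else 0 with hGe
  have hFe_mono : Monotone Fe := by
    intro C C' hCC'
    refine hh _ _ (union_subset_union (fun a ha => ?_) (fun a ha => ?_))
    · exact SimpleGraph.Reachable.mono (openGraph_mono hCC') ha
    · exact SimpleGraph.Reachable.mono (openGraph_mono hCC') ha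
  have hGe_mono : Monotone Ge := by
    intro C C' hCC'
    simp only [hGe]
    by_cases hr : (openGraph C).Reachable o x
    · rw [if_pos hr, if_pos (hr.mono (openGraph_mono hCC'))]
    · rw [if_neg hr]; split_ifs <;> norm_num
  have hxS : x ∈ S := by simp [hS]
  have hoS : o ∈ S := by simp [hS]
  have hFe_eq : ∀ ω : BondConfig V, Fe (⋃ s ∈ S, openEdgeCluster ω s) = f ω := by
    intro ω
    simp only [hFe, hf]
    congr 1
    ext a
    simp only [mem_union, mem_setOf_eq, openCluster]
    rw [← KNSep.reachable_iff_cluster ω S hxS a, ← KNSep.reachable_iff_cluster ω S hoS a]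
  have hGe_eq : ∀ ω : BondConfig V, Ge (⋃ s ∈ S, openEdgeCluster ω s) = Ox.indicator 1 ω := by
    intro ω
    simp only [hGe]
    rw [← KNSep.reachable_iff_cluster ω S hoS x]
    by_cases hr : (openGraph ω).Reachable o x
    · rw [if_pos hr, indicator_of_mem (show ω ∈ Ox from hr), Pi.one_apply]
    · rw [if_neg hr, indicator_of_notMem (show ω ∉ Ox from hr)]
  have hPA := BHK2006_setClusterConditionalPositiveAssociation w S T Fe Ge hFe_mono hGe_mono
  simp_rw [hFe_eq, hGe_eq] at hPA
  rw [setIntegral_indicator_one_eq μ Q Ox, setIntegral_mul_indicator_one μ Q Ox f] at hPA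
  -- hPA : (∫_Q f) * μ(Q ∩ Ox) ≤ μ Q * ∫_{Q ∩ Ox} f
  change (∫ ω in Q, f ω ∂μ) * μ.real (Q ∩ Ox) ≤ μ.real Q * ∫ ω in Q ∩ Ox, f ω ∂μ at hPA
  -- split `Q = (Q ∩ Ox) ⊔ (Q ∩ Oxᶜ)`
  have hc : Q ∩ {ω | ¬ (openGraph ω).Reachable o x} = Q \ Ox := by
    ext ω; simp [hOx, openConn]
  have iQ : ∫ ω in Q, f ω ∂μ = ∫ ω in Q ∩ Ox, f ω ∂μ + ∫ ω in Q \ Ox, f ω ∂μ :=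
    (integral_inter_add_sdiff (hmeas Ox) (hint f Q)).symm
  have mQ : μ.real Q = μ.real (Q ∩ Ox) + μ.real (Q \ Ox) :=
    (measureReal_inter_add_sdiff (s := Q) (h := measure_ne_top _ _) (hmeas Ox)).symm
  rw [hc]
  rw [iQ, mQ] at hPA
  nlinarith [hPA, hn (Q ∩ Ox), hn (Q \ Ox)]

end PocketCert

end

end Summit.CriticalPhenomena.PercolationContinuityZ3.Theorems
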